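import Mathlib
import Summits.PneNP.PneNP.Theorems.OverlapGapAlgebraSolvableImpliesStableSectionRerandomize
import Summits.PneNP.PneNP.Theorems.OverlapGapAlgebraSolvableImpliesStableSectionFilteredRepairLocal
import Summits.PneNP.PneNP.Theorems.OverlapGapAlgebraSolvableImpliesStableSectionFilteredRepairMoments

/-!
# PneNP / OverlapGapAlgebra — crux `SolvableImpliesStableSection` (stmt-PneNP-2463):
# the FILTERED REPAIR block (4/6) — the mean number of violated clauses, one clause at a time

Support for crux `stmt-PneNP-2463` (`Summit.PneNP.PneNP.Theses.OverlapGapAlgebra.SolvableImpliesStableSection`).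
For the filtered repair map `g` (`g Φ v = true ↔ v` is the first variable of an all-positive clause and
no clause of `Φ` is critical for `v`) and a fixed clause `i`, the number of instances `Φ` (out of
`#Inst = (2n)^{km}`) in which clause `i` is violated by `g Φ` satisfies the counting inequality
`sissF_count_viol_le`:
`(2n)^k · #{Φ : clause i violated} + n^k (2n)^k ((2n)^k - k(n+1)^{k-1})^{m-1}
   ≤ n^k #Inst + C(k,2) Σ_{r ≤ k-2} C(k-2,r) [n^k W_inj(r+2) + (r+2)² n^{k-1} W_one]`,
`W_inj(t) = m^t (2n)^k n^{(k-1)t} ((2n)^k - t k n^{k-1})^{m-1-t}`, `W_one = W_inj(1)`.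
Proof: by `sissF_viol_cases` the violation indicator is dominated by a functional of clause `i` and of
the statistics `(S', U')` of the other clauses (designated-and-safe variables, unsafe variables);
re-randomise clause `i` (`stub_rerandomize`), count the two fibres (`sissF_fibreA_le`,
`sissF_fibreB_le`), expand `s²(n+s)^{k-2}` binomially and use the moments `sissF_sum_pow_card_le` and
the unsafe count `sissF_sum_card_unsafe_le`.  Normalised by `(2n)^k #Inst` this is the mean bound
`2^{-k}(1 - (1-c₁)^{m-1}) + C(k,2) Σ_t C(k-2,t-2) 2^{-k} (m2^{-k}/n)^t (1 - t c₀)^{m-1-t} + O(1/n)` of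
file `…FilteredRepairAsymptotics`.
No new definitions; axioms `propext`, `Classical.choice`, `Quot.sound`.
-/

set_option linter.dupNamespace false -- `Summit.PneNP.PneNP.…`: summit = sub-problem (D-0017)

namespace Summit.PneNP.PneNP.Theorems

open Finset
open scoped Classical

section FilteredRepairMean

/-- Binomial expansion of the fibre-B polynomial: `s² (n+s)^{k-2} = Σ_{r<k-1} C(k-2,r) s^{r+2} n^{k-2-r}`. -/
theorem sissF_fibrePoly_eq (k n s : ℕ) (hk2 : 2 ≤ k) :
    s ^ 2 * (n + s) ^ (k - 2) = ∑ r ∈ range (k - 1), (k - 2).choose r * (s ^ (r + 2) * n ^ (k - 2 - r)) := by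
  have h : k - 1 = k - 2 + 1 := by omega
  rw [h, add_comm n s, add_pow, mul_sum]
  refine sum_congr rfl fun r _ => ?_
  simp only [Nat.cast_id]
  ring

/-- **The counting inequality for one clause.** See the module docstring. -/
theorem sissF_count_viol_le {k m n : ℕ} (hk : 0 < k) (hk2 : 2 ≤ k)
    (g : (Fin m → Fin k → Fin n × Bool) → (Fin n → Bool))
    (hg : ∀ (Φ : Fin m → Fin k → Fin n × Bool) (v : Fin n),
      g Φ v = true ↔ (∃ a : Fin m, (Φ a ⟨0, hk⟩).1 = v ∧ ∀ j, (Φ a j).2 = true) ∧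
        ¬ ∃ a : Fin m, (∃ j, (Φ a j).2 = false) ∧ ∀ j, (Φ a j).2 = false → (Φ a j).1 = v)
    (i : Fin m) :
    (2 * n) ^ k * ((univ : Finset (Fin m → Fin k → Fin n × Bool)).filter fun Φ =>
        ∀ j, g Φ (Φ i j).1 ≠ (Φ i j).2).card
      + n ^ k * ((2 * n) ^ k * ((2 * n) ^ k - k * (n + 1) ^ (k - 1)) ^ (m - 1))
    ≤ n ^ k * Fintype.card (Fin m → Fin k → Fin n × Bool)
      + k.choose 2 * ∑ r ∈ range (k - 1), (k - 2).choose r *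
          (n ^ k * (m ^ (r + 2) * ((2 * n) ^ k * (n ^ (k - 1)) ^ (r + 2) *
              ((2 * n) ^ k - (r + 2) * (k * n ^ (k - 1))) ^ (m - 1 - (r + 2))))
            + (r + 2) * (r + 2) * n ^ (k - 1) * (m ^ 1 * ((2 * n) ^ k * (n ^ (k - 1)) ^ 1 *
              ((2 * n) ^ k - 1 * (k * n ^ (k - 1))) ^ (m - 1 - 1)))) := by
  -- the statistics of the other clauses
  set S' : (Fin m → Fin k → Fin n × Bool) → Finset (Fin n) := fun Φ => univ.filter fun v =>
    (∃ a, a ≠ i ∧ (Φ a ⟨0, hk⟩).1 = v ∧ ∀ j, (Φ a j).2 = true) ∧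
      ∀ a, a ≠ i → ¬ ((∃ j, (Φ a j).2 = false) ∧ ∀ j, (Φ a j).2 = false → (Φ a j).1 = v) with hS'
  set U' : (Fin m → Fin k → Fin n × Bool) → Finset (Fin n) := fun Φ => univ.filter fun v =>
    ∃ a, a ≠ i ∧ (∃ j, (Φ a j).2 = false) ∧ ∀ j, (Φ a j).2 = false → (Φ a j).1 = v with hU'
  set R : (Fin m → Fin k → Fin n × Bool) → Finset (Fin n) × Finset (Fin n) := fun Φ => (S' Φ, U' Φ)
    with hR
  -- the clause functional: fibre A + fibre B
  set hf : (Fin k → Fin n × Bool) → Finset (Fin n) × Finset (Fin n) → ℝ := fun c p =>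
    (if (∀ j, (c j).2 = true) ∧ (c ⟨0, hk⟩).1 ∈ p.2 then (1 : ℝ) else 0) +
    (if (∀ j, (c j).2 = false → (c j).1 ∈ p.1) ∧
        ∃ j j', (c j).2 = false ∧ (c j').2 = false ∧ (c j).1 ≠ (c j').1 then (1 : ℝ) else 0)
    with hhf
  -- domination of the violation indicator
  have hdom : ∀ Φ : Fin m → Fin k → Fin n × Bool,
      (if ∀ j, g Φ (Φ i j).1 ≠ (Φ i j).2 then (1 : ℝ) else 0) ≤ hf (Φ i) (R Φ) := by
    intro Φ
    have hnn : (0 : ℝ) ≤ hf (Φ i) (R Φ) := by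
      simp only [hhf]
      positivity
    by_cases hv : ∀ j, g Φ (Φ i j).1 ≠ (Φ i j).2
    · rw [if_pos hv]
      rcases sissF_viol_cases hk g hg Φ i hv with ⟨hall, a, hai, hcrit⟩ | ⟨_, hneg, hpair⟩
      · have hA : (∀ j, (Φ i j).2 = true) ∧ (Φ i ⟨0, hk⟩).1 ∈ (R Φ).2 := by
          refine ⟨hall, ?_⟩
          simp only [hR, hU', mem_filter, mem_univ, true_and]
          exact ⟨a, hai, hcrit⟩
        simp only [hhf]
        rw [if_pos hA]
        have : (0 : ℝ) ≤ (if (∀ j, (Φ i j).2 = false → (Φ i j).1 ∈ (R Φ).1) ∧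
            ∃ j j', (Φ i j).2 = false ∧ (Φ i j').2 = false ∧ (Φ i j).1 ≠ (Φ i j').1
            then (1 : ℝ) else 0) := by positivity
        linarith
      · have hB : (∀ j, (Φ i j).2 = false → (Φ i j).1 ∈ (R Φ).1) ∧
            ∃ j j', (Φ i j).2 = false ∧ (Φ i j').2 = false ∧ (Φ i j).1 ≠ (Φ i j').1 := by
          refine ⟨fun j hj => ?_, hpair⟩
          simp only [hR, hS', mem_filter, mem_univ, true_and]
          exact hneg j hj
        simp only [hhf]
        rw [if_pos hB]
        have : (0 : ℝ) ≤ (if (∀ j, (Φ i j).2 = true) ∧ (Φ i ⟨0, hk⟩).1 ∈ (R Φ).2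
            then (1 : ℝ) else 0) := by positivity
        linarith
    · rw [if_neg hv]
      exact hnn
  -- the statistics do not read clause `i`
  have hRupd : ∀ (Φ : Fin m → Fin k → Fin n × Bool) (c : Fin k → Fin n × Bool),
      R (Function.update Φ i c) = R Φ := by
    intro Φ c
    have hne : ∀ a, a ≠ i → Function.update Φ i c a = Φ a := fun a ha => Function.update_of_ne ha _ _
    simp only [hR, hS', hU', Prod.mk.injEq]
    constructor
    · refine filter_congr fun v _ => ?_
      constructor
      · rintro ⟨⟨a, hai, h1, h2⟩, h3⟩
        refine ⟨⟨a, hai, by rw [← hne a hai]; exact h1, by rw [← hne a hai]; exact h2⟩, fun a hai => ?_⟩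
        rw [← hne a hai]; exact h3 a hai
      · rintro ⟨⟨a, hai, h1, h2⟩, h3⟩
        refine ⟨⟨a, hai, by rw [hne a hai]; exact h1, by rw [hne a hai]; exact h2⟩, fun a hai => ?_⟩
        rw [hne a hai]; exact h3 a hai
    · refine filter_congr fun v _ => ?_
      constructor
      · rintro ⟨a, hai, h⟩
        exact ⟨a, hai, by rw [← hne a hai]; exact h⟩
      · rintro ⟨a, hai, h⟩
        exact ⟨a, hai, by rw [hne a hai]; exact h⟩
  -- re-randomise clause `i`
  have hre := Summit.PneNP.PneNP.Cruxes.SolvableImpliesStableSection.Sketch.stub_rerandomize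
    (C := Fin k → Fin n × Bool) i R hRupd hf
  -- the fibre sum for fixed statistics
  have hfib : ∀ p : Finset (Fin n) × Finset (Fin n), ∑ c : Fin k → Fin n × Bool, hf c p
      ≤ ((p.2.card * n ^ (k - 1) + k.choose 2 * (p.1.card ^ 2 * (n + p.1.card) ^ (k - 2)) : ℕ) : ℝ) := by
    intro p
    simp only [hhf]
    rw [sum_add_distrib, ← natCast_card_filter, ← natCast_card_filter]
    push_cast
    have hA := sissF_fibreA_le (k := k) (n := n) hk p.2
    have hB := sissF_fibreB_le (k := k) (n := n) p.1
    have hA' : ((((univ : Finset (Fin k → Fin n × Bool)).filter fun c =>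
        (∀ j, (c j).2 = true) ∧ (c ⟨0, hk⟩).1 ∈ p.2).card : ℕ) : ℝ) ≤ (p.2.card : ℝ) * (n : ℝ) ^ (k - 1) := by
      exact_mod_cast hA
    have hB' : ((((univ : Finset (Fin k → Fin n × Bool)).filter fun c =>
        (∀ j, (c j).2 = false → (c j).1 ∈ p.1) ∧
        ∃ j j', (c j).2 = false ∧ (c j').2 = false ∧ (c j).1 ≠ (c j').1).card : ℕ) : ℝ)
        ≤ (k.choose 2 : ℝ) * ((p.1.card : ℝ) ^ 2 * ((n : ℝ) + p.1.card) ^ (k - 2)) := by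
      exact_mod_cast hB
    linarith
  -- the counting form of: (2n)^k · #V ≤ Σ_Φ (fibre A + fibre B)
  have hstep : (2 * n) ^ k * (((univ : Finset (Fin m → Fin k → Fin n × Bool)).filter fun Φ =>
        ∀ j, g Φ (Φ i j).1 ≠ (Φ i j).2).card)
      ≤ ∑ Φ : Fin m → Fin k → Fin n × Bool,
          ((U' Φ).card * n ^ (k - 1) + k.choose 2 * ((S' Φ).card ^ 2 * (n + (S' Φ).card) ^ (k - 2))) := by
    have h1 : ((2 * n : ℕ) : ℝ) ^ k * ∑ Φ : Fin m → Fin k → Fin n × Bool,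
        (if ∀ j, g Φ (Φ i j).1 ≠ (Φ i j).2 then (1 : ℝ) else 0)
        ≤ ((2 * n : ℕ) : ℝ) ^ k * ∑ Φ : Fin m → Fin k → Fin n × Bool, hf (Φ i) (R Φ) :=
      mul_le_mul_of_nonneg_left (sum_le_sum fun Φ _ => hdom Φ) (by positivity)
    have hC : (Fintype.card (Fin k → Fin n × Bool) : ℝ) = ((2 * n : ℕ) : ℝ) ^ k := by
      rw [Fintype.card_fun, Fintype.card_prod, Fintype.card_fin, Fintype.card_bool, Fintype.card_fin,
        mul_comm]
      push_cast; ring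
    rw [← hC, hre] at h1
    have h2 : ∑ Φ : Fin m → Fin k → Fin n × Bool, ∑ c : Fin k → Fin n × Bool, hf c (R Φ)
        ≤ ∑ Φ : Fin m → Fin k → Fin n × Bool,
          ((((U' Φ).card * n ^ (k - 1) + k.choose 2 * ((S' Φ).card ^ 2 * (n + (S' Φ).card) ^ (k - 2))) : ℕ) : ℝ) :=
      sum_le_sum fun Φ _ => hfib (R Φ)
    have h3 := h1.trans h2
    rw [← natCast_card_filter, hC] at h3
    exact_mod_cast h3
  -- fibre A summed: the unsafe count
  have hAsum : ∑ Φ : Fin m → Fin k → Fin n × Bool, (U' Φ).card * n ^ (k - 1)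
      + n ^ k * ((2 * n) ^ k * ((2 * n) ^ k - k * (n + 1) ^ (k - 1)) ^ (m - 1))
      ≤ n ^ k * Fintype.card (Fin m → Fin k → Fin n × Bool) := by
    have h := sissF_sum_card_unsafe_le (k := k) (m := m) (n := n) i
    have e : n ^ k = n ^ (k - 1) * n := by
      rw [← pow_succ]; congr 1; omega
    have h1 : ∑ Φ : Fin m → Fin k → Fin n × Bool, (U' Φ).card * n ^ (k - 1)
        + n ^ k * ((2 * n) ^ k * ((2 * n) ^ k - k * (n + 1) ^ (k - 1)) ^ (m - 1))
        = n ^ (k - 1) * (∑ Φ : Fin m → Fin k → Fin n × Bool, (U' Φ).card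
          + n * ((2 * n) ^ k * ((2 * n) ^ k - k * (n + 1) ^ (k - 1)) ^ (m - 1))) := by
      rw [e, ← sum_mul]; ring
    rw [h1, e, mul_assoc]
    exact Nat.mul_le_mul_left _ (by simpa only [hU'] using h)
  -- fibre B summed: moments
  have hBsum : ∑ Φ : Fin m → Fin k → Fin n × Bool, (S' Φ).card ^ 2 * (n + (S' Φ).card) ^ (k - 2)
      ≤ ∑ r ∈ range (k - 1), (k - 2).choose r *
          (n ^ k * (m ^ (r + 2) * ((2 * n) ^ k * (n ^ (k - 1)) ^ (r + 2) *
              ((2 * n) ^ k - (r + 2) * (k * n ^ (k - 1))) ^ (m - 1 - (r + 2))))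
            + (r + 2) * (r + 2) * n ^ (k - 1) * (m ^ 1 * ((2 * n) ^ k * (n ^ (k - 1)) ^ 1 *
              ((2 * n) ^ k - 1 * (k * n ^ (k - 1))) ^ (m - 1 - 1)))) := by
    calc ∑ Φ : Fin m → Fin k → Fin n × Bool, (S' Φ).card ^ 2 * (n + (S' Φ).card) ^ (k - 2)
        = ∑ Φ : Fin m → Fin k → Fin n × Bool, ∑ r ∈ range (k - 1),
            (k - 2).choose r * ((S' Φ).card ^ (r + 2) * n ^ (k - 2 - r)) :=
          sum_congr rfl fun Φ _ => sissF_fibrePoly_eq k n _ hk2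
      _ = ∑ r ∈ range (k - 1), ∑ Φ : Fin m → Fin k → Fin n × Bool,
            (k - 2).choose r * ((S' Φ).card ^ (r + 2) * n ^ (k - 2 - r)) := sum_comm
      _ = ∑ r ∈ range (k - 1), (k - 2).choose r * (n ^ (k - 2 - r) *
            ∑ Φ : Fin m → Fin k → Fin n × Bool, (S' Φ).card ^ (r + 2)) := by
          refine sum_congr rfl fun r _ => ?_
          rw [mul_sum, mul_sum]
          refine sum_congr rfl fun Φ _ => ?_
          ring
      _ ≤ _ := by
          refine sum_le_sum fun r hr => ?_
          have hrk : r ≤ k - 2 := by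
            have := mem_range.1 hr; omega
          refine Nat.mul_le_mul_left _ ?_
          have hmom := sissF_sum_pow_card_le (k := k) (m := m) (n := n) hk i (r + 2) (by omega)
          have hmom' : ∑ Φ : Fin m → Fin k → Fin n × Bool, (S' Φ).card ^ (r + 2)
              ≤ n ^ (r + 2) * (m ^ (r + 2) * ((2 * n) ^ k * (n ^ (k - 1)) ^ (r + 2) *
                  ((2 * n) ^ k - (r + 2) * (k * n ^ (k - 1))) ^ (m - 1 - (r + 2))))
                + (r + 2) * (r + 2) * n ^ (r + 2 - 1) * (m ^ 1 * ((2 * n) ^ k * (n ^ (k - 1)) ^ 1 *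
                  ((2 * n) ^ k - 1 * (k * n ^ (k - 1))) ^ (m - 1 - 1))) := by
            simpa only [hS'] using hmom
          refine le_trans (Nat.mul_le_mul_left _ hmom') (le_of_eq ?_)
          have e1 : n ^ (k - 2 - r) * n ^ (r + 2) = n ^ k := by
            rw [← pow_add]; congr 1; omega
          have e2 : n ^ (k - 2 - r) * n ^ (r + 2 - 1) = n ^ (k - 1) := by
            rw [← pow_add]; congr 1; omega
          rw [Nat.mul_add, ← mul_assoc, e1]
          congr 1
          calc n ^ (k - 2 - r) * ((r + 2) * (r + 2) * n ^ (r + 2 - 1) * (m ^ 1 * ((2 * n) ^ k *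
                (n ^ (k - 1)) ^ 1 * ((2 * n) ^ k - 1 * (k * n ^ (k - 1))) ^ (m - 1 - 1))))
              = (r + 2) * (r + 2) * (n ^ (k - 2 - r) * n ^ (r + 2 - 1)) * (m ^ 1 * ((2 * n) ^ k *
                (n ^ (k - 1)) ^ 1 * ((2 * n) ^ k - 1 * (k * n ^ (k - 1))) ^ (m - 1 - 1))) := by ring
            _ = _ := by rw [e2]
  -- assemble
  calc (2 * n) ^ k * (((univ : Finset (Fin m → Fin k → Fin n × Bool)).filter fun Φ =>
          ∀ j, g Φ (Φ i j).1 ≠ (Φ i j).2).card)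
        + n ^ k * ((2 * n) ^ k * ((2 * n) ^ k - k * (n + 1) ^ (k - 1)) ^ (m - 1))
      ≤ ∑ Φ : Fin m → Fin k → Fin n × Bool,
          ((U' Φ).card * n ^ (k - 1) + k.choose 2 * ((S' Φ).card ^ 2 * (n + (S' Φ).card) ^ (k - 2)))
        + n ^ k * ((2 * n) ^ k * ((2 * n) ^ k - k * (n + 1) ^ (k - 1)) ^ (m - 1)) :=
        Nat.add_le_add_right hstep _
    _ = (∑ Φ : Fin m → Fin k → Fin n × Bool, (U' Φ).card * n ^ (k - 1)
          + n ^ k * ((2 * n) ^ k * ((2 * n) ^ k - k * (n + 1) ^ (k - 1)) ^ (m - 1)))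
        + k.choose 2 * ∑ Φ : Fin m → Fin k → Fin n × Bool,
            (S' Φ).card ^ 2 * (n + (S' Φ).card) ^ (k - 2) := by
        rw [sum_add_distrib, ← mul_sum]; ring
    _ ≤ _ := Nat.add_le_add hAsum (Nat.mul_le_mul_left _ hBsum)

end FilteredRepairMean

end Summit.PneNP.PneNP.Theorems
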